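import Literature.AlgebraicGeometry.Motives.HodgeLieRealPlacesSl2
import Literature.AlgebraicGeometry.Motives.WeilTypeCMProofs
import HarnessLib

/-!
# Hodge endomorphisms are self-adjoint for EVERY polarization when `End_Hdg(V) ⊗ ℂ` is diagonalised by REAL characters (weight one) — the hypothesis `hself` of `HodgeLieRealPlacesSl2` is automatic

Family `hodge`, layer `Literature/AlgebraicGeometry/Motives`. Research context: cell `pub-hodge-ring2`
(HONEST FRAMING: research route conditional on HC_CM; not a corollary; Q11.4-sentence-2 already refuted in
dim ≥ 3), Literature lane, programme R3 brick B′5 (`pub-hodge-ring2-lit-g40/PLAN-R3.md`). UNCONDITIONAL Hodge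
linear algebra; no step towards a summit statement.

PUBLISHED STATEMENT (Shimura, *Abelian Varieties with Complex Multiplication and Modular Functions*, §5.1
Lemma 2 with Prop. 5, pp. 35–36): the Rosati involution of a polarization induces on (the centre of) the
endomorphism algebra an involution `ξ ↦ ξ^ρ` with «for every isomorphism `τ` of `K` into `C`, `ξ^{ρτ}` is
the complex conjugate of `ξ^τ`»; when all `τ` are real the involution is the identity (Prop. 5: `K₀ = K`
totally real). Huybrechts, *Lectures on K3 surfaces*, Lemma 3.3.12: the adjoint of a Hodge endomorphism
is a Hodge endomorphism.

SETTING AND RESULTS. `H` a `ℚ`-Hodge structure of weight `n = 1`, effective, on `V`; `ψ` ANY polarization;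
`σ_i : End_Hdg(V) → ℂ` characters with eigenblocks `T_{σ_i} = H.eigenBlock (σ i)` (ZarhinHodgeGroupBlocks).
* `exists_mem_eigenBlock_ne_zero_mem_piece` — a non-zero eigenblock contains a non-zero vector of pure type
  `(1,0)` or `(0,1)` (`T_σ = (T_σ ∩ F¹) ⊕ (T_σ ∩ conj F¹)`: Hodge endomorphisms preserve `F¹` and, being real,
  `conj F¹`);
* `character_adjoint_eq_conj` — **`σ(a′) = conj σ(a)`** whenever `(a, a′)` is a `ψ`-adjoint pair of Hodge
  endomorphisms and `T_σ ≠ 0` (pair `ψ_ℂ(x, conj x) ≠ 0` on a pure-type eigenvector, second Hodge–Riemann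
  relation `Polarization.form_conj_ne_zero`; `conj x ∈ T_{σ̄}`, `conj_mem_eigenBlock`) — the abstract form of
  the tree's `ComplexMultiplication.apply_eq_conj_of_isAdjointPair` (there: `End⁰(B)` a FIELD acting on `H¹`);
* `isAdjointPair_self_of_real_characters` — **if the `σ_i` are REAL (`conj ∘ σ_i = σ_i`) and their
  eigenblocks form an internal direct sum of `V_ℂ`, EVERY Hodge endomorphism `a` is `ψ`-self-adjoint for
  EVERY polarization `ψ`**: the `ψ`-adjoint `a′` exists (`ψ` non-degenerate), is a Hodge endomorphism
  (Huybrechts 3.3.12 = `Polarization.mem_endAlg_of_isAdjointPair`), and `σ_i(a′) = conj σ_i(a) = σ_i(a)` on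
  every block, so `a′ = a`;
* `mem_hodgeLie_iff_commute_and_skew_of_real_characters` / `mem_hodgeLieC_iff_mapsTo_and_skew_of_real_characters`
  — the theorems of `HodgeLieRealPlacesSl2` (R2a: `Lie Hdg = 𝔰𝔭_E(V, ψ)`, `Lie Hdg_ℂ = ⊕ 𝔰𝔩(T_σ)`) with the
  hypothesis `hself` REMOVED (weight one). USE: for `V = H¹(A₁ × A₂)` with `End_Hdg = E₁ × E₂` a product of
  totally real fields (R3) no Rosati-type argument on `E₁ × E₂` is needed.

No definitions, no named fact (D-0026); axioms standard.

## References

* [Shimura1998] G. Shimura, *Abelian Varieties with Complex Multiplication and Modular Functions* (1998),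
  §5.1 Lemma 2 and Proposition 5 (pp. 35–36). [cite: Shimura1998, §5.1 Lemma 2 and Proposition 5]
* [Huybrechts2016K3] D. Huybrechts, *Lectures on K3 Surfaces* (CUP 2016), §3.3 Lemma 3.3.12, Rem. 3.3.14 (iii).
  [cite: Huybrechts2016K3, Lemma 3.3.12 and Rem. 3.3.14 (iii)]
* [VoisinHodgeI2002] C. Voisin, *Hodge Theory and Complex Algebraic Geometry I*, §7.1.2 Def. 7.7
  (second Hodge–Riemann relation). [cite: VoisinHodgeI2002, §7.1.2 Def. 7.7]
* [Hazama1983] F. Hazama, Tôhoku Math. J. 35 (1983), §3; [Ribet1983] K. A. Ribet, Amer. J. Math. 105 (1983),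
  Thm. 0–1 (the application). [cite: Hazama1983, §3 (pp. 305–306)] [cite: Ribet1983, Thm. 0–1]
-/

noncomputable section

open scoped TensorProduct

namespace Literature.AlgebraicGeometry.Motives

namespace HodgeStructure

universe u

variable {V : Type u} [AddCommGroup V] [Module ℚ V] {n : ℤ}

/-! ### §1 Eigenblocks split along the Hodge decomposition (weight one) -/

/-- For a Hodge endomorphism `a` and `z ∈ conj F¹`: `a_ℂ z ∈ conj F¹` (`a_ℂ` is real and preserves `F¹`).
[cite: Huybrechts2016K3, Rem. 3.3.14 (iii)] -/
theorem baseChange_mem_complexConj_F (H : HodgeStructure V n) (a : H.endAlg) (p : ℤ) {z : ℂ ⊗[ℚ] V}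
    (hz : z ∈ complexConj (H.F p)) : (a : Module.End ℚ V).baseChange ℂ z ∈ complexConj (H.F p) := by
  rw [mem_complexConj] at hz ⊢
  rw [conj_baseChange]
  exact a.2 p (Submodule.mem_map_of_mem hz)

/-- **A non-zero eigenblock of `End_Hdg(V)` (weight one, effective) contains a non-zero vector of pure
Hodge type**: `T_σ = (T_σ ∩ V^{1,0}) ⊕ (T_σ ∩ V^{0,1})`, because every Hodge endomorphism preserves
`F¹ = V^{1,0}` and `conj F¹ = V^{0,1}` and `V_ℂ = F¹ ⊕ conj F¹`. [cite: Huybrechts2016K3, Rem. 3.3.14 (iii)] -/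
theorem exists_mem_eigenBlock_ne_zero_mem_piece (H : HodgeStructure V n) (hn : n = 1)
    (heff : H.IsEffective) (σ : H.endAlg →+* ℂ) (hσ : H.eigenBlock σ ≠ ⊥) :
    ∃ x ∈ H.eigenBlock σ, x ≠ 0 ∧ ∃ p q : ℤ, p + q = n ∧ x ∈ H.piece p q := by
  subst hn
  have hc : IsCompl (H.F 1) (complexConj (H.F 1)) := H.isCompl_F_complexConj 1 1 (by norm_num)
  obtain ⟨x, hxT, hx0⟩ := Submodule.exists_mem_ne_zero_of_ne_bot hσ
  -- decompose `x = y + z` along `F¹ ⊕ conj F¹`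
  have hx : x ∈ H.F 1 ⊔ complexConj (H.F 1) := by rw [hc.sup_eq_top]; exact Submodule.mem_top
  obtain ⟨y, hy, z, hz, rfl⟩ := Submodule.mem_sup.1 hx
  -- both components lie in the eigenblock
  have hcomp : ∀ a : H.endAlg, (a : Module.End ℚ V).baseChange ℂ y = σ a • y ∧
      (a : Module.End ℚ V).baseChange ℂ z = σ a • z := by
    intro a
    have hsum := (H.mem_eigenBlock_iff σ (y + z)).1 hxT a
    rw [map_add, smul_add] at hsum
    -- `(a y - σ a • y) = -(a z - σ a • z)` lies in `F¹ ∩ conj F¹ = 0`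
    have hF : (a : Module.End ℚ V).baseChange ℂ y - σ a • y ∈ H.F 1 :=
      Submodule.sub_mem _ (a.2 1 (Submodule.mem_map_of_mem hy)) (Submodule.smul_mem _ _ hy)
    have hC : (a : Module.End ℚ V).baseChange ℂ z - σ a • z ∈ complexConj (H.F 1) :=
      Submodule.sub_mem _ (H.baseChange_mem_complexConj_F a 1 hz) (Submodule.smul_mem _ _ hz)
    have heq : (a : Module.End ℚ V).baseChange ℂ y - σ a • y =
        -((a : Module.End ℚ V).baseChange ℂ z - σ a • z) := by
      rw [eq_neg_iff_add_eq_zero]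
      have : (a : Module.End ℚ V).baseChange ℂ y + (a : Module.End ℚ V).baseChange ℂ z -
          (σ a • y + σ a • z) = 0 := sub_eq_zero.2 hsum
      rw [← this]; abel
    have hmem : (a : Module.End ℚ V).baseChange ℂ y - σ a • y ∈ H.F 1 ⊓ complexConj (H.F 1) :=
      Submodule.mem_inf.2 ⟨hF, heq ▸ Submodule.neg_mem _ hC⟩
    rw [hc.inf_eq_bot, Submodule.mem_bot] at hmem
    have hz' : (a : Module.End ℚ V).baseChange ℂ z - σ a • z = 0 := by
      rw [hmem, eq_comm, neg_eq_zero] at heq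
      exact heq
    exact ⟨sub_eq_zero.1 hmem, sub_eq_zero.1 hz'⟩
  have hyT : y ∈ H.eigenBlock σ := (H.mem_eigenBlock_iff σ y).2 fun a => (hcomp a).1
  have hzT : z ∈ H.eigenBlock σ := (H.mem_eigenBlock_iff σ z).2 fun a => (hcomp a).2
  by_cases hy0 : y = 0
  · subst hy0
    rw [zero_add] at hx0
    refine ⟨z, hzT, hx0, 0, 1, by norm_num, ?_⟩
    rw [piece_of_add_eq _ (by norm_num), heff.F_eq_top le_rfl]
    exact Submodule.mem_inf.2 ⟨Submodule.mem_top, hz⟩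
  · refine ⟨y, hyT, hy0, 1, 0, by norm_num, ?_⟩
    rw [piece_one_zero_eq_F heff]
    exact hy

/-! ### §2 The adjoint of a Hodge endomorphism is complex conjugation under every character -/

/-- **`σ(a′) = conj σ(a)` for a `ψ`-adjoint pair `(a, a′)` of Hodge endomorphisms and a character `σ` with
non-zero eigenblock** (weight one): for a pure-type `0 ≠ x ∈ T_σ`, `ψ_ℂ(x, conj x) ≠ 0`,
`conj x ∈ T_{σ̄}`, and `σ(a) ψ_ℂ(x, conj x) = ψ_ℂ(a x, conj x) = ψ_ℂ(x, a′ conj x) = conj σ(a′) ψ_ℂ(x, conj x)`.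
Shimura §5.1 Lemma 2: «`ξ^{ρτ}` is the complex conjugate of `ξ^τ`».
[cite: Shimura1998, §5.1 Lemma 2 and Proposition 5] [cite: VoisinHodgeI2002, §7.1.2 Def. 7.7] -/
theorem character_adjoint_eq_conj (H : HodgeStructure V n) (hn : n = 1) (heff : H.IsEffective)
    (ψ : H.Polarization) {σ : H.endAlg →+* ℂ} (hσ : H.eigenBlock σ ≠ ⊥) {a a' : H.endAlg}
    (h : LinearMap.IsAdjointPair ψ.form ψ.form (a : Module.End ℚ V) (a' : Module.End ℚ V)) :
    σ a' = starRingEnd ℂ (σ a) := by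
  obtain ⟨x, hxT, hx0, p, q, hpq, hxpq⟩ := H.exists_mem_eigenBlock_ne_zero_mem_piece hn heff σ hσ
  have hne : ψ.form.baseChange ℂ x (conj x) ≠ 0 := ψ.form_conj_ne_zero hpq hxpq hx0
  have hxa : (a : Module.End ℚ V).baseChange ℂ x = σ a • x := (H.mem_eigenBlock_iff σ x).1 hxT a
  have hxa' : (a' : Module.End ℚ V).baseChange ℂ (conj x) = starRingEnd ℂ (σ a') • conj x := by
    have h1 := (H.mem_eigenBlock_iff _ (conj x)).1 (H.conj_mem_eigenBlock hxT) a'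
    rw [RingHom.comp_apply] at h1
    exact h1
  have hadj := isAdjointPair_baseChange h x (conj x)
  rw [hxa, hxa', map_smul, LinearMap.smul_apply, map_smul, smul_eq_mul, smul_eq_mul] at hadj
  have key : σ a = starRingEnd ℂ (σ a') := mul_right_cancel₀ hne hadj
  rw [key, Complex.conj_conj]

/-! ### §3 Self-adjointness of all Hodge endomorphisms from real characters -/

/-- For a `(-1)ⁿ`-symmetric form a left adjoint is a right adjoint (the tree's
`ComplexMultiplication.isAdjointPair_symm_of_polarization`, re-proved to keep the import cone inside
`Motives/`). [folklore] -/
private theorem isAdjointPair_symm' {H : HodgeStructure V n} (ψ : H.Polarization) {f g : Module.End ℚ V}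
    (h : LinearMap.IsAdjointPair ψ.form ψ.form g f) : LinearMap.IsAdjointPair ψ.form ψ.form f g := by
  intro x y
  have hε : ((((n.negOnePow : ℤˣ) : ℤ) : ℚ)) * (((n.negOnePow : ℤˣ) : ℤ) : ℚ) = 1 := by
    rw [← Int.cast_mul, ← Units.val_mul, Int.units_mul_self, Units.val_one, Int.cast_one]
  rw [ψ.form_swap y (f x), ← h y x, ψ.form_swap x (g y), ← mul_assoc, hε, one_mul]

/-- Two rational endomorphisms with equal complexifications are equal (`V → V_ℂ` is injective).
[folklore] -/
private theorem eq_of_baseChange_eq {f g : Module.End ℚ V} (h : f.baseChange ℂ = g.baseChange ℂ) : f = g := by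
  refine LinearMap.ext fun v => ofRat_injective ?_
  have hv := LinearMap.congr_fun h (ofRat v)
  simpa [ofRat, LinearMap.baseChange_tmul] using hv

/-- **Real characters with exhausting eigenblocks force every Hodge endomorphism to be `ψ`-self-adjoint,
for EVERY polarization `ψ`** (weight one, effective). Proof: the adjoint `a′` of `a ∈ End_Hdg` exists
(`ψ` is non-degenerate) and lies in `End_Hdg` (Huybrechts Lemma 3.3.12); on each non-zero block `T_{σ_i}`
both act by scalars, `σ_i(a′) = conj σ_i(a) = σ_i(a)` (`character_adjoint_eq_conj`, reality); the blocks
span `V_ℂ`, so `a′_ℂ = a_ℂ` and `a′ = a`. Shimura §5.1 Prop. 5 (totally real case: the involution is the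
identity). [cite: Shimura1998, §5.1 Lemma 2 and Proposition 5] [cite: Huybrechts2016K3, Lemma 3.3.12 and Rem. 3.3.14 (iii)] -/
theorem isAdjointPair_self_of_real_characters [Module.Finite ℚ V] {ι : Type*} [DecidableEq ι]
    (H : HodgeStructure V n) (hn : n = 1) (heff : H.IsEffective) (ψ : H.Polarization)
    (σ : ι → (H.endAlg →+* ℂ)) (hreal : ∀ i, (starRingEnd ℂ).comp (σ i) = σ i)
    (hint : DirectSum.IsInternal fun i => H.eigenBlock (σ i)) (a : H.endAlg) :
    LinearMap.IsAdjointPair ψ.form ψ.form (a : Module.End ℚ V) (a : Module.End ℚ V) := by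
  -- the adjoint `g` of `a`
  set g := ψ.form.leftAdjointOfNondegenerate ψ.nondegenerate (a : Module.End ℚ V) with hg
  have hga : LinearMap.IsAdjointPair ψ.form ψ.form g (a : Module.End ℚ V) :=
    ψ.form.isAdjointPairLeftAdjointOfNondegenerate ψ.nondegenerate _
  have hag : LinearMap.IsAdjointPair ψ.form ψ.form (a : Module.End ℚ V) g := isAdjointPair_symm' ψ hga
  have hgH : g ∈ H.endAlg := ψ.mem_endAlg_of_isAdjointPair a.2 hag
  set a' : H.endAlg := ⟨g, hgH⟩ with ha'
  have hag' : LinearMap.IsAdjointPair ψ.form ψ.form (a : Module.End ℚ V) (a' : Module.End ℚ V) := hag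
  -- `a'` and `a` agree on every block
  have hblock : ∀ i, ∀ x ∈ H.eigenBlock (σ i),
      (a' : Module.End ℚ V).baseChange ℂ x = (a : Module.End ℚ V).baseChange ℂ x := by
    intro i x hx
    by_cases hbot : H.eigenBlock (σ i) = ⊥
    · rw [hbot, Submodule.mem_bot] at hx
      rw [hx, map_zero, map_zero]
    · have hchar : σ i a' = σ i a := by
        rw [H.character_adjoint_eq_conj hn heff ψ hbot hag']
        have hr := RingHom.congr_fun (hreal i) a
        rwa [RingHom.comp_apply] at hr
      rw [(H.mem_eigenBlock_iff (σ i) x).1 hx a', (H.mem_eigenBlock_iff (σ i) x).1 hx a, hchar]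
  -- hence everywhere on `V_ℂ = ⊕ T_{σ_i}`
  have hall : ∀ x : ℂ ⊗[ℚ] V,
      (a' : Module.End ℚ V).baseChange ℂ x = (a : Module.End ℚ V).baseChange ℂ x := by
    intro x
    have hx : x ∈ ⨆ i, H.eigenBlock (σ i) := by rw [hint.submodule_iSup_eq_top]; exact Submodule.mem_top
    induction hx using Submodule.iSup_induction' with
    | mem i x hx => exact hblock i x hx
    | zero => rw [map_zero, map_zero]
    | add x y _ _ hx hy => rw [map_add, map_add, hx, hy]
  have heq : (a' : Module.End ℚ V) = (a : Module.End ℚ V) := eq_of_baseChange_eq (LinearMap.ext hall)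
  intro v w
  have hvw := hag' v w
  rw [heq] at hvw
  exact hvw

/-! ### §4 `Lie Hdg = 𝔰𝔭_E(V, ψ)` without the self-adjointness hypothesis (weight one) -/

/-- **`Lie Hdg(H) = 𝔰𝔭_E(V, ψ)` (rational form) for a weight-one effective Hodge structure whose
endomorphism algebra is diagonalised by REAL characters with two-dimensional blocks — for EVERY polarization
`ψ`, with NO self-adjointness hypothesis** (the tree's `mem_hodgeLie_iff_commute_and_skew`, its `hself` supplied
by `isAdjointPair_self_of_real_characters`). [cite: Hazama1983, §3 (pp. 305–306)] [cite: Ribet1983, Thm. 0–1]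
[cite: Shimura1998, §5.1 Lemma 2 and Proposition 5] -/
theorem mem_hodgeLie_iff_commute_and_skew_of_real_characters [Module.Finite ℚ V] [HodgeTensorFacts.{u, u}]
    {ι : Type*} [Fintype ι] [DecidableEq ι] (H : HodgeStructure V n) (hn : n = 1) (heff : H.IsEffective)
    (ψ : H.Polarization) (σ : ι → (H.endAlg →+* ℂ)) (hreal : ∀ i, (starRingEnd ℂ).comp (σ i) = σ i)
    (hint : DirectSum.IsInternal fun i => H.eigenBlock (σ i))
    (h2 : ∀ i, Module.finrank ℂ (H.eigenBlock (σ i)) = 2) (X : Module.End ℚ V) :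
    X ∈ H.hodgeLie ↔
      (∀ a : H.endAlg, X * (a : Module.End ℚ V) = (a : Module.End ℚ V) * X) ∧
      (∀ v w, ψ.form (X v) w + ψ.form v (X w) = 0) :=
  H.mem_hodgeLie_iff_commute_and_skew (by subst hn; exact odd_one) ψ
    (H.isAdjointPair_self_of_real_characters hn heff ψ σ hreal hint) σ hreal hint h2 X

/-- **Block form over `ℂ`, without `hself`**: `Y ∈ Lie Hdg(H) ⊗ ℂ` iff `Y` preserves every block `T_{σ_i}`
and is `ψ_ℂ`-skew (`Lie Hdg_ℂ = ⊕_i 𝔰𝔩(T_{σ_i})`). [cite: Hazama1983, §3 (pp. 305–306)] [cite: Ribet1983, Thm. 0–1] -/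
theorem mem_hodgeLieC_iff_mapsTo_and_skew_of_real_characters [Module.Finite ℚ V] [HodgeTensorFacts.{u, u}]
    {ι : Type*} [Fintype ι] [DecidableEq ι] (H : HodgeStructure V n) (hn : n = 1) (heff : H.IsEffective)
    (ψ : H.Polarization) (σ : ι → (H.endAlg →+* ℂ)) (hreal : ∀ i, (starRingEnd ℂ).comp (σ i) = σ i)
    (hint : DirectSum.IsInternal fun i => H.eigenBlock (σ i))
    (h2 : ∀ i, Module.finrank ℂ (H.eigenBlock (σ i)) = 2) (Y : Module.End ℂ (ℂ ⊗[ℚ] V)) :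
    Y ∈ H.hodgeLieC ↔
      (∀ i, Set.MapsTo Y (H.eigenBlock (σ i)) (H.eigenBlock (σ i))) ∧
      (∀ x y, ψ.form.baseChange ℂ (Y x) y + ψ.form.baseChange ℂ x (Y y) = 0) :=
  H.mem_hodgeLieC_iff_mapsTo_and_skew (by subst hn; exact odd_one) ψ
    (H.isAdjointPair_self_of_real_characters hn heff ψ σ hreal hint) σ hreal hint h2 Y

end HodgeStructure

end Literature.AlgebraicGeometry.Motives

end
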